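import Summits.ResolutionOfSingularities.ResolutionOfSingularities.Theses.MaxContactCut
import Summits.ResolutionOfSingularities.ResolutionOfSingularities.Theorems.DivergentTowerClasses
import Summits.ResolutionOfSingularities.ResolutionOfSingularities.Theorems.MaxContactCutTauLadder
import Summits.ResolutionOfSingularities.ResolutionOfSingularities.Theorems.MaxContactCutForcedTowers
import HarnessLib

/-!
# MaxContactCutDivergentTowers — kernels of the decomp-res node «DivergentTowers» (lens-4 g8) BY NAME

Source HOME/decomp-res-lens-4/g8/DivergentTowers.lean (sha256 8ba89e0503aedfc1; ForcedTowers rev 2; critic `lean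
check` rc 0, 0 sorry), CRITIC-LEDGER row 52 (2026-08-30): CLEARED AS ATTACK NODE rev 2.  The node refines
MaxContactCut's aside `NoForcedTowers` (30253; and through it the located dim-4 core in sequence form `RungOne`,
29273, `E 2 → E 1`) by the classical PROXIMITY / SHANNON calculus of infinitely near points, typed route-independently
in `Theorems/DivergentTowerClasses` over the landed `ForcedTowerClasses` towers:

* `NoForcedTowers ⟺ NoEventuallyFreeTowers ∧ NoTauTwoHuggingTowers ∧ (germ-hugging towers die) ∧ (valuative towers
  die)` — EXACT by excluded middle (`noForcedTowers_iff_ttLeaves`);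
* over PERFECT ground fields the eventually-free leaf is DECIDED modulo the ports `TowerDivergenceAll` (the NEW
  LEMMA (M1), an aside = prover target #11) and `ProximityLaw` (Casas-Alvero Thm 3.5.3), and the τ ≥ 2 hugging leaf
  IS the port `ConeLineLaw` (`noEventuallyFreeTowers_perfect`, `noTauTwoHuggingTowers_perfect`);
* under lens-2's `E 2` only CORE towers matter (port `ClassTwoTailsDie`): `RungOne ⟸ ports ∧ NoEventuallyFreeTowers ∧
  NoCoreGermHuggingTowers ∧ NoCoreValuativeTowers ∧ (E 2-conditional nowhere-isolated reduction)`
  (`rungOne_of_located`), hence the core 28544 with the ladder's costume `SequenceToStepAll` (`core_of_located`);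
* necessity of every leaf modulo the counting port `TowerObstructs` (`ttLeaves_of_e_one`, `coreLeaves_of_rungOne`).

Route items touched BY NAME: `NoForcedTowers` 30253, `NowhereIsolatedReduction` 30254, `RungOne` 29273,
`SequenceToStepAll` 29274, `StepDimFour` 28011, `StepPICoreDimFour` 28544 and the g8 asides `NoEventuallyFreeTowers`,
`NoTauTwoHuggingTowers`, `NoCoreGermHuggingTowers`, `NoCoreValuativeTowers`, `TowerDivergenceAll`.  Census remark (not
a theorem here: g7's `EventuallyFree` counts satellites against `dropLast` of the whole boundary, g8's
`EventuallyFreeOwn` against the tower's OWN components): on the perfect column the node also decides g7's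
`NoStationaryFreeTowers` (30255) without arcs.  Pure logic over the class files; every proof is a few lines.
(Sources: CasasAlvero2000 Thm 3.5.3, §3.6; KiyekVicente2004 VII (7.1), VIII (6.12); Shannon1973;
HeinzerOlberdingToeniskoetter2017; Kollar2007 3.75–3.76; CossartJannsenSaito2020 Ch. 2–3.)
-/

namespace Summit.ResolutionOfSingularities.ResolutionOfSingularities.Theorems.MaxContactCutDivergentTowers

open Summit.ResolutionOfSingularities.ResolutionOfSingularities.Theses
open Summit.ResolutionOfSingularities.ResolutionOfSingularities.Theorems
open WeakOrderReduction ForcedTowerClasses DivergentTowerClasses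

/-! ## EXACT leaf calculus of the g8 refinement -/

/-- **EXACT**: `NoForcedTowers (30253) ⟺ NoEventuallyFreeTowers ∧ NoTauTwoHuggingTowers ∧ (∀ n ≥ 1, germ-hugging
towers die) ∧ (∀ n ≥ 1, valuative towers die)` — excluded middle on «satellite-recurrent», then Shannon's trichotomy.
[folklore] -/
theorem noForcedTowers_iff_ttLeaves : MaxContactCut.NoForcedTowers ↔
    MaxContactCut.NoEventuallyFreeTowers ∧ MaxContactCut.NoTauTwoHuggingTowers ∧
      (∀ n : ℕ, 1 ≤ n → GermHuggingTowersTerminate n) ∧ (∀ n : ℕ, 1 ≤ n → ValuativeTowersTerminate n) :=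
  ⟨fun h =>
    ⟨fun n hn => (leaves_of_ftt (h n hn)).1, fun n hn => (leaves_of_ftt (h n hn)).2.2.1,
      fun n hn => (leaves_of_ftt (h n hn)).2.2.2.1, fun n hn => (leaves_of_ftt (h n hn)).2.2.2.2⟩,
    fun h n hn => ftt_iff_free_satellite.mpr ⟨h.1 n hn, srtt_of_leaves (h.2.1 n hn) (h.2.2.1 n hn) (h.2.2.2 n hn)⟩⟩

/-- The satellite-recurrent half of 30253 from the three Shannon leaves. [folklore] -/
theorem noSatelliteRecurrentTowers_of_leaves (h2 : MaxContactCut.NoTauTwoHuggingTowers)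
    (hG : ∀ n : ℕ, 1 ≤ n → GermHuggingTowersTerminate n) (hW : ∀ n : ℕ, 1 ≤ n → ValuativeTowersTerminate n) :
    ∀ n : ℕ, 1 ≤ n → SatelliteRecurrentTowersTerminate n :=
  fun n hn => srtt_of_leaves (h2 n hn) (hG n hn) (hW n hn)

/-- Every g8 aside is implied by 30253 (WEAKER-or-equal by construction). [folklore] -/
theorem ttAsides_of_noForcedTowers (h : MaxContactCut.NoForcedTowers) :
    MaxContactCut.NoEventuallyFreeTowers ∧ MaxContactCut.NoTauTwoHuggingTowers ∧
      MaxContactCut.NoCoreGermHuggingTowers ∧ MaxContactCut.NoCoreValuativeTowers := by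
  refine ⟨fun n hn => (leaves_of_ftt (h n hn)).1, fun n hn => (leaves_of_ftt (h n hn)).2.2.1, fun n hn => ?_,
    fun n hn => ?_⟩
  · have hL := leaves_of_ftt (h n hn)
    exact (coreLeaves_of_leaves hL.2.2.1 hL.2.2.2.1 hL.2.2.2.2).1
  · have hL := leaves_of_ftt (h n hn)
    exact (coreLeaves_of_leaves hL.2.2.1 hL.2.2.2.1 hL.2.2.2.2).2

/-! ## The PERFECT column: what the ports decide -/

/-- (M1)+(M2): over perfect ground fields NO eventually-free forced tower survives, from the asides' port
`TowerDivergenceAll` (NEW LEMMA, prover target #11) and the classical `ProximityLaw`. [folklore] -/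
theorem noEventuallyFreeTowers_perfect (hV : MaxContactCut.TowerDivergenceAll)
    (hL : ∀ n : ℕ, 1 ≤ n → ProximityLaw n) : ∀ n : ℕ, 1 ≤ n → NoTowerPerfect n EventuallyFreeOwn :=
  fun n hn => eventuallyFree_perfect_of_ports (hV n hn) (hL n hn)

/-- (M3, first Shannon leaf): over perfect ground fields the τ ≥ 2 hugging leaf IS the port `ConeLineLaw`.
[folklore] -/
theorem noTauTwoHuggingTowers_perfect (hC : ∀ n : ℕ, 1 ≤ n → ConeLineLaw n) :
    ∀ n : ℕ, 1 ≤ n → NoTowerPerfect n fun T => TauTwoHugging T n :=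
  fun n hn => tauTwoHugging_perfect_of_coneLineLaw (hC n hn)

/-- Over perfect ground fields the WHOLE tower piece 30253 reduces to the two open Shannon leaves. [folklore] -/
theorem noForcedTowers_perfect_of_leaves (hV : MaxContactCut.TowerDivergenceAll)
    (hL : ∀ n : ℕ, 1 ≤ n → ProximityLaw n) (hC : ∀ n : ℕ, 1 ≤ n → ConeLineLaw n)
    (hG : ∀ n : ℕ, 1 ≤ n → GermHuggingTowersTerminate n) (hW : ∀ n : ℕ, 1 ≤ n → ValuativeTowersTerminate n) :
    ∀ n : ℕ, 1 ≤ n → NoTowerPerfect n fun _ => True :=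
  fun n hn => forcedTowers_perfect_of_leaves (hV n hn) (hL n hn) (hC n hn) (hG n hn) (hW n hn)

/-- (M4) on the perfect column: under `E 2` only the two CORE asides remain. [folklore] -/
theorem noForcedTowers_perfect_of_coreLeaves (hE2 : E 2) (hP : ∀ n : ℕ, 1 ≤ n → ClassTwoTailsDie n)
    (hV : MaxContactCut.TowerDivergenceAll) (hL : ∀ n : ℕ, 1 ≤ n → ProximityLaw n)
    (hG : MaxContactCut.NoCoreGermHuggingTowers) (hW : MaxContactCut.NoCoreValuativeTowers) :
    ∀ n : ℕ, 1 ≤ n → NoTowerPerfect n fun _ => True :=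
  fun n hn => forcedTowers_perfect_of_coreLeaves (hE2 n hn) (hP n hn) (hV n hn) (hL n hn) (hG n hn) (hW n hn)

/-! ## Up: the asides settle 30253, RungOne (29273), 28011 and the core 28544 BY NAME -/

/-- (M4): under `E 2` the tower piece 30253 follows from the eventually-free aside and the two CORE asides (port
`ClassTwoTailsDie` absorbs every tower with a stage of class ≥ 2). [folklore] -/
theorem noForcedTowers_of_coreLeaves (hE2 : E 2) (hP : ∀ n : ℕ, 1 ≤ n → ClassTwoTailsDie n)
    (hF : MaxContactCut.NoEventuallyFreeTowers) (hG : MaxContactCut.NoCoreGermHuggingTowers)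
    (hW : MaxContactCut.NoCoreValuativeTowers) : MaxContactCut.NoForcedTowers :=
  fun n hn => ftt_of_coreLeaves (hE2 n hn) (hP n hn) (hF n hn) (hG n hn) (hW n hn)

/-- **THE NODE AT THE BLOCKER 29273 BY NAME**: `RungOne ⟸ ports ForcedSeed, ForcedDescent, ClassTwoTailsDie ∧
NoEventuallyFreeTowers ∧ NoCoreGermHuggingTowers ∧ NoCoreValuativeTowers ∧ (E 2-conditional nowhere-isolated
reduction)`. [folklore] -/
theorem rungOne_of_located (hS : ∀ n : ℕ, 1 ≤ n → ForcedSeed n) (hD : ∀ n : ℕ, 1 ≤ n → ForcedDescent n)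
    (hP : ∀ n : ℕ, 1 ≤ n → ClassTwoTailsDie n) (hF : MaxContactCut.NoEventuallyFreeTowers)
    (hG : MaxContactCut.NoCoreGermHuggingTowers) (hW : MaxContactCut.NoCoreValuativeTowers)
    (hN : ∀ n : ℕ, 1 ≤ n → SeqDimFour 2 n → NonIsolatedReduction n) : MaxContactCut.RungOne := by
  intro hE2 n hn
  exact seqDimFour_one_of_wor (wor_of_forced (hS n hn) (hD n hn)
    (ftt_of_coreLeaves (hE2 n hn) (hP n hn) (hF n hn) (hG n hn) (hW n hn)) (hN n hn (hE2 n hn)))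

/-- Variant with the g7 aside `NowhereIsolatedReduction` (30254) BY NAME in place of its `E 2`-conditional form.
[folklore] -/
theorem rungOne_of_located' (hS : ∀ n : ℕ, 1 ≤ n → ForcedSeed n) (hD : ∀ n : ℕ, 1 ≤ n → ForcedDescent n)
    (hP : ∀ n : ℕ, 1 ≤ n → ClassTwoTailsDie n) (hF : MaxContactCut.NoEventuallyFreeTowers)
    (hG : MaxContactCut.NoCoreGermHuggingTowers) (hW : MaxContactCut.NoCoreValuativeTowers)
    (hN : MaxContactCut.NowhereIsolatedReduction) : MaxContactCut.RungOne :=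
  rungOne_of_located hS hD hP hF hG hW fun n hn _ => hN n hn

/-- With the ladder's costume `SequenceToStepAll` (29274): the dim-4 step 28011 BY NAME. [folklore] -/
theorem stepDimFour_of_located (hS : ∀ n : ℕ, 1 ≤ n → ForcedSeed n) (hD : ∀ n : ℕ, 1 ≤ n → ForcedDescent n)
    (hP : ∀ n : ℕ, 1 ≤ n → ClassTwoTailsDie n) (hF : MaxContactCut.NoEventuallyFreeTowers)
    (hG : MaxContactCut.NoCoreGermHuggingTowers) (hW : MaxContactCut.NoCoreValuativeTowers)
    (hN : ∀ n : ℕ, 1 ≤ n → SeqDimFour 2 n → NonIsolatedReduction n) (hE2 : E 2)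
    (hStep : MaxContactCut.SequenceToStepAll) : MaxContactCut.StepDimFour :=
  hStep (rungOne_of_located hS hD hP hF hG hW hN hE2)

/-- … and the located dim-4 core 28544 BY NAME. [folklore] -/
theorem core_of_located (hS : ∀ n : ℕ, 1 ≤ n → ForcedSeed n) (hD : ∀ n : ℕ, 1 ≤ n → ForcedDescent n)
    (hP : ∀ n : ℕ, 1 ≤ n → ClassTwoTailsDie n) (hF : MaxContactCut.NoEventuallyFreeTowers)
    (hG : MaxContactCut.NoCoreGermHuggingTowers) (hW : MaxContactCut.NoCoreValuativeTowers)
    (hN : ∀ n : ℕ, 1 ≤ n → SeqDimFour 2 n → NonIsolatedReduction n) (hE2 : E 2)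
    (hStep : MaxContactCut.SequenceToStepAll) : MaxContactCut.StepPICoreDimFour :=
  MaxContactCutTauLadder.stepPICoreDimFour_of_stepDimFour (stepDimFour_of_located hS hD hP hF hG hW hN hE2 hStep)

/-! ## Down: necessity modulo the counting port `TowerObstructs` -/

/-- Every TT leaf (all five) and nowhere-isolated reduction follow from `E 1` modulo `TowerObstructs`. [folklore] -/
theorem ttLeaves_of_e_one (hT : ∀ n : ℕ, 1 ≤ n → TowerObstructs n) (h : E 1) :
    MaxContactCut.NoEventuallyFreeTowers ∧ MaxContactCut.NoTauTwoHuggingTowers ∧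
      MaxContactCut.NoCoreGermHuggingTowers ∧ MaxContactCut.NoCoreValuativeTowers ∧
        MaxContactCut.NowhereIsolatedReduction :=
  have hQ : MaxContactCut.NoForcedTowers := MaxContactCutForcedTowers.noForcedTowers_of_e_one hT h
  have hA := ttAsides_of_noForcedTowers hQ
  ⟨hA.1, hA.2.1, hA.2.2.1, hA.2.2.2, MaxContactCutForcedTowers.nowhereIsolatedReduction_of_e_one h⟩

/-- Hence under `E 2` the four g8 asides are NECESSARY for `RungOne` modulo `TowerObstructs` (every refinement of
29273 loses exactly the hypothesis `E 2`). [folklore] -/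
theorem coreLeaves_of_rungOne (hT : ∀ n : ℕ, 1 ≤ n → TowerObstructs n) (hE2 : E 2) (h : MaxContactCut.RungOne) :
    MaxContactCut.NoEventuallyFreeTowers ∧ MaxContactCut.NoTauTwoHuggingTowers ∧
      MaxContactCut.NoCoreGermHuggingTowers ∧ MaxContactCut.NoCoreValuativeTowers :=
  have hA := ttLeaves_of_e_one hT (h hE2)
  ⟨hA.1, hA.2.1, hA.2.2.1, hA.2.2.2.1⟩

/-- **EXACT at the blocker modulo ports**: under `E 2`, `TowerObstructs`, `ForcedSeed`, `ForcedDescent`,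
`ClassTwoTailsDie` and nowhere-isolated reduction, `RungOne ⟺ NoEventuallyFreeTowers ∧ NoCoreGermHuggingTowers ∧
NoCoreValuativeTowers`. [folklore] -/
theorem rungOne_iff_coreLeaves (hT : ∀ n : ℕ, 1 ≤ n → TowerObstructs n)
    (hS : ∀ n : ℕ, 1 ≤ n → ForcedSeed n) (hD : ∀ n : ℕ, 1 ≤ n → ForcedDescent n)
    (hP : ∀ n : ℕ, 1 ≤ n → ClassTwoTailsDie n) (hN : MaxContactCut.NowhereIsolatedReduction) (hE2 : E 2) :
    MaxContactCut.RungOne ↔ MaxContactCut.NoEventuallyFreeTowers ∧ MaxContactCut.NoCoreGermHuggingTowers ∧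
      MaxContactCut.NoCoreValuativeTowers :=
  ⟨fun h => have hA := coreLeaves_of_rungOne hT hE2 h; ⟨hA.1, hA.2.2.1, hA.2.2.2⟩,
    fun h => rungOne_of_located' hS hD hP h.1 h.2.1 h.2.2 hN⟩

end Summit.ResolutionOfSingularities.ResolutionOfSingularities.Theorems.MaxContactCutDivergentTowers
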